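import Summits.HodgeConjecture.HodgeConjecture.Theorems.K2E1TraceFormulaBetaDefs   -- ★ p854778: tier-0 vocabulary `Pl`, `HLoc`, `StGlobKit`, `E1St1383Letter` (+ ★ `Gqs`, ★ `IrrClass.smoothTrace`)
import HarnessLib

/-!
# K2·E1 — row 22 «ReadOffAtPlace» PROPER: the identity AT `v` of the engine socket `stub_E1_St1383` READ OFF the pinned (13.8.3)
# [Rogawski1990 §13.8 pp. 218–219: «The equality (13.8.3) becomes `2Σ m(π)ε_π Tr(π^∞(f^∞)) = 2Tr(ρ^∞((f^∞)^H))` … we obtain our equality of the form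
# `Σ a(π_w) Tr(π_w(f_w)) = Tr(ρ₀(f_w^H))`»] — the ASSEMBLY MAP rows 13–18 → tier 0, every posited equation named

Track B ∕ K2-LIT, crux h413 = `stmt-HodgeConjecture-24833`, route of record `HCCMUnconditional`; cell `hodgecm-mathlib`, squad K2; prover seat `hodgecm-mathlib-K2E1-p08` (g0),
BY-NAME DEAL of the dealer K2E1-plan (g0) 2026-09-03T22:28:47Z; lane `--supports stmt-HodgeConjecture-24833 --as helper` (count-neutral).  THEOREMS ONLY (no `def`, no
instance, no notation, no named-fact `Prop`, no `sorry`).  HONEST LABEL: HC_CM is proved only modulo the 7 printed citations (2 remaining named inputs: hLiu418 =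
`stmt-HodgeConjecture-24832`, h413 = `stmt-HodgeConjecture-24833`) until rung 0 closes; this file PROVES ONLY THE READ-OFF ALGEBRA of p. 219 — the four displayed inputs
of print's paragraph enter as EXPLICIT HYPOTHESES (they are TABLE rows 13–18, not yet in the tree in concrete form), listed here with their provenance.

## What the consumer needs
★ `K2E1StGlobKitOfLevelCut.e1St1383Letter_of_levelCut_identity` (K2E1-p09, p855123) reduces ★ `E1St1383Letter` to: «∃ automorphic `μG`, a finite index `ι` of occurring
families `loc i`, `m i ≥ 1`, `ε i = ±1`, such that for every smooth Δ‴_{Φ₃}-matched pair `(f^H, φ)` at `v`: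
`Summable (i ↦ m_i ε_i Tr (loc i)_v(φ)) ∧ Σ'_i m_i ε_i Tr (loc i)_v(φ) = Tr St_H(ξ_v)(f^H)`».  This file supplies the LAST clause — the identity at `v` — from the
pinned global comparison, in exactly that shape (`identityAt_of_pinned1383`), over an abstract matching predicate `Match f^H φ` (the consumer instantiates it with
tier 0's `IsLocSmooth f^H ∧ IsLocSmooth φ ∧ IsLocalDeltaTransfer … f^H φ`).

## The posited equations (hypotheses of `identityAt_of_pinned1383`; print p. 218 l. −12 – p. 219 l. 6)
* `hEq` — **(13.8.3) PINNED** at the test vectors of (G1)(G3)(G4): for matched `(f^H_v, φ_v)` at `v`, with the off-`v` components FROZEN (units at finite `u ≠ v`,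
  pseudo-coefficients at ∞), «`Tr(I_{ρ̃′}(φ)I_{ρ̃′}(ε)) = 2 Σ_i m(π_i) Tr(π_i(φ_v ⊗ f^v)) − Tr(ρ(f^H_v ⊗ (f^v)^H))`» over the finite level cut `ι` of contributing `π_i`
  [display (13.8.3) p. 218].  SOURCE WHEN BUILT: ★ `Rogawski1990.TwistedComparisonData.eq1383_of_laws` (`trIS ρ φS = 2 * mSum (germI ρ) fS − trHS ρ fHS`, rows 13–17:
  main equality Thm. 10.3.1, matching, germ expansion, separation Prop. 13.7.1, endoscopic coefficient Lemma 13.6.3) INSTANTIATED on the concrete test spaces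
  (★ `UnitaryGroup.PureTensor`, rows 13∕14 — not yet concrete: POSITED here as the functional equation between `trTw`, `trG`, `trH`).
* `hTw` — **the twisted side VANISHES for this test vector**: «The stable orbital integrals of `f_u` vanish and we can take `φ_u = 0`» at the distinguished infinite place
  `u` [p. 218 l. −6], so `φ = ⊗_v φ_v = 0` and `Tr(I(φ)I(ε)) = 0`.  (Row 16∕17, archimedean: K2E1b's pseudo-coefficients; POSITED as `trTw φ_v = 0`.)
* `hFlathG` — **Flath factorisation on `G` + units + signs**: `Tr π_i(φ_v ⊗ f^v) = Tr π_{i,v}(φ_v) · ∏_{u ≠ v finite} Tr π_{i,u}(1_{K_u}) · Tr π_{i,∞}(f_∞) = Tr (loc i)_v(φ_v) · 1 · ε_i`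
  [row 18 Flath Thm. 3; p. 219 l. 3–4 «π_u = ξ_H(ρ_u)» unramified so `Tr π_{i,u}(1_{K_u}) = 1`; p. 219 l. 1 `ε_π = ±1` from Prop. 12.3.2].  POSITED as
  `trG i φ_v = ε_i · (loc i v).smoothTrace νQv φ_v`.
* `hFlathH` — **the `H`-side**: `Tr ρ(f^H_v ⊗ (f^v)^H) = Tr ρ_v(f^H_v) · ∏_{u ≠ v finite} Tr ρ_u(1_{K_{H,u}}) · Tr ρ_∞(f_∞^H) = Tr ρ₀(f^H_v) · 1 · 2` [p. 218 l. −5: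
  `Tr(ρ_u(f_u^H)) = 2`, l. −2: `Tr(ρ_v(f_v^H)) = 1` at the other infinite places; (G1)(iii) `ρ_v = ρ₀ = St_H(ξ_v)`; the fundamental lemma for units §4.9 at finite `u ≠ v`].
  POSITED as `trH f^H_v = 2 · πSt.smoothTrace νHv f^H_v`.
PROVED: from these, `Σ'_i m_i ε_i Tr (loc i)_v(φ_v) = Tr St_H(ξ_v)(f^H_v)` with its (finite-index) summability — the «a(π_w) ∈ ℤ» read-off is then tier 0's own
★ `stSpectralHyp_of_line` (fibre regrouping).  §1 is the bare algebra over abstract functionals; §2 the tier-0 currency.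

References: [Rogawski1990] §13.8 Prop. 13.8.3 (proof) pp. 218–219, display (13.8.3); §13.7 Prop. 13.7.1 p. 213; Lemma 13.6.3; §12.3 Prop. 12.3.2 p. 178; §4.9 (units);
[FlathCorvallis1979] Thm. 3.
-/

set_option autoImplicit false
-- the mandated namespace repeats the single-problem summit's segment (`HodgeConjecture.HodgeConjecture`)
set_option linter.dupNamespace false

noncomputable section

open NumberField IsDedekindDomain MeasureTheory
open scoped Matrix MatrixGroups
open Literature.NumberTheory.Rogawski1990 Literature.NumberTheory.Automorphic Literature.NumberTheory.Automorphic.UnitaryGroup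
open Summit.HodgeConjecture.HodgeConjecture.Cruxes.H413.K2E1TraceFormulaBeta (Pl HLoc)

namespace Summit.HodgeConjecture.HodgeConjecture.Cruxes.H413.K2E1ReadOffAtPlace

/-! ## §1 The read-off algebra over abstract functionals -/

/-- **READ-OFF, abstract form.**  Over a FINITE index `ι` with multiplicities `m` and signs `ε`, local trace functionals `T i` on `G_v`-test vectors `x : X` and `TH` on
`H_v`-test vectors `y : Y`, and a matching relation `Match y x`: if the pinned comparison `trTw x = 2 Σ_i m_i · trG i x − trH y` holds on matched pairs (`hEq`), the
twisted side vanishes (`hTw`), `trG i x = ε_i · T i x` (`hFlathG`) and `trH y = 2 · TH y` (`hFlathH`), then `Σ'_i m_i ε_i T i x = TH y` on matched pairs, with its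
summability. [cite: Rogawski1990, §13.8 Prop. 13.8.3 (proof) pp. 218–219] -/
theorem readOff_of_pinned {ι : Type} [Finite ι] {X Y : Type} (m : ι → ℕ) (ε : ι → ℤ) (T : ι → X → ℂ) (TH : Y → ℂ) (Match : Y → X → Prop)
    (trTw : X → ℂ) (trG : ι → X → ℂ) (trH : Y → ℂ)
    (hEq : ∀ (y : Y) (x : X), Match y x → trTw x = 2 * ∑ᶠ i, (m i : ℂ) * trG i x - trH y)
    (hTw : ∀ (y : Y) (x : X), Match y x → trTw x = 0)
    (hFlathG : ∀ (i : ι) (y : Y) (x : X), Match y x → trG i x = (ε i : ℂ) * T i x)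
    (hFlathH : ∀ (y : Y) (x : X), Match y x → trH y = 2 * TH y) :
    ∀ (y : Y) (x : X), Match y x →
      Summable (fun i : ι => (m i : ℂ) * (ε i : ℂ) * T i x) ∧ ∑' i : ι, (m i : ℂ) * (ε i : ℂ) * T i x = TH y := by
  intro y x hm
  haveI : Fintype ι := Fintype.ofFinite ι
  refine ⟨Summable.of_finite, ?_⟩
  have h := hEq y x hm
  rw [hTw y x hm, hFlathH y x hm, finsum_eq_sum_of_fintype] at h
  rw [tsum_fintype]
  have h2 : ∑ i, (m i : ℂ) * (ε i : ℂ) * T i x = ∑ i, (m i : ℂ) * trG i x :=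
    Finset.sum_congr rfl (fun i _ => by rw [hFlathG i y x hm, mul_assoc])
  rw [h2]
  linear_combination (-(1 : ℂ) / 2) * h

/-! ## §2 Tier-0 currency: the identity at `v` of `stub_E1_St1383` from the pinned (13.8.3) -/

variable {L : Type} [Field L] [NumberField L] [IsCMField L]

/-- **THE IDENTITY AT `v` READ OFF THE PINNED (13.8.3)** — the last clause of ★ `e1St1383Letter_of_levelCut_identity`'s hypothesis, in its exact shape.  Data: the finite
level cut `ι` with families `loc i` of local classes of `U(Φ₃)(L⁺_u)`, `m i`, `ε i`; the local measures `νQv` on `U(Φ₃)(L⁺_v)` and `νHv` on `H_v`; the `H_v`-class `πSt`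
(`= St_H(ξ_v)`, tier-0 binder); a matching predicate `Match f^H φ` on test functions at `v` (tier 0: `IsLocSmooth f^H ∧ IsLocSmooth φ ∧ IsLocalDeltaTransfer … f^H φ`); and
the three GLOBAL trace functionals of the frozen test vector — `trTw φ = Tr(I_{ρ̃′}(φ ⊗ φ^v)I(ε))`, `trG i φ = Tr π_i(φ ⊗ f^v)`, `trH f^H = Tr ρ(f^H ⊗ (f^v)^H)`.  Hypotheses =
the four posited equations of the module docstring (`hEq` (13.8.3) pinned, `hTw` «φ_u = 0», `hFlathG` Flath + units + `ε`, `hFlathH` Flath + `2` + units).  Conclusion: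
for every matched pair, `Summable (i ↦ m_i ε_i Tr (loc i)_v(φ)) ∧ Σ'_i m_i ε_i (loc i v).smoothTrace νQv φ = πSt.smoothTrace νHv f^H`.
[cite: Rogawski1990, §13.8 Prop. 13.8.3 (proof) pp. 218–219, display (13.8.3)] [cite: FlathCorvallis1979, Thm. 3] -/
theorem identityAt_of_pinned1383 (v : Pl L) {ι : Type} [Finite ι]
    (loc : ι → ∀ u : Pl L, IrrClass (Gqs L u)) (m : ι → ℕ) (ε : ι → ℤ)
    [MeasurableSpace (Gqs L v)] [MeasurableSpace (HLoc L v)] (νQv : Measure (Gqs L v)) (νHv : Measure (HLoc L v))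
    (πSt : IrrClass (HLoc L v)) (Match : (HLoc L v → ℂ) → (Gqs L v → ℂ) → Prop)
    (trTw : (Gqs L v → ℂ) → ℂ) (trG : ι → (Gqs L v → ℂ) → ℂ) (trH : (HLoc L v → ℂ) → ℂ)
    (hEq : ∀ (fH : HLoc L v → ℂ) (φ : Gqs L v → ℂ), Match fH φ → trTw φ = 2 * ∑ᶠ i, (m i : ℂ) * trG i φ - trH fH)
    (hTw : ∀ (fH : HLoc L v → ℂ) (φ : Gqs L v → ℂ), Match fH φ → trTw φ = 0)
    (hFlathG : ∀ (i : ι) (fH : HLoc L v → ℂ) (φ : Gqs L v → ℂ), Match fH φ → trG i φ = (ε i : ℂ) * (loc i v).smoothTrace νQv φ)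
    (hFlathH : ∀ (fH : HLoc L v → ℂ) (φ : Gqs L v → ℂ), Match fH φ → trH fH = 2 * πSt.smoothTrace νHv fH) :
    ∀ (fH : HLoc L v → ℂ) (φ : Gqs L v → ℂ), Match fH φ →
      Summable (fun i : ι => (m i : ℂ) * (ε i : ℂ) * (loc i v).smoothTrace νQv φ) ∧
        ∑' i : ι, (m i : ℂ) * (ε i : ℂ) * (loc i v).smoothTrace νQv φ = πSt.smoothTrace νHv fH :=
  readOff_of_pinned m ε (fun i φ => (loc i v).smoothTrace νQv φ) (fun fH => πSt.smoothTrace νHv fH) Match trTw trG trH hEq hTw hFlathG hFlathH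

end Summit.HodgeConjecture.HodgeConjecture.Cruxes.H413.K2E1ReadOffAtPlace

end
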